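/-
Copyright (c) 2026 the pub-hodgecm-mathlib formalisation cell (harness21).  Prover seat hodgecm-mathlib-K2Liu-p09 (g3): Track B «K2-LIT», #184♮ = hLiu418,
payer-internal organ O5-inert «(H) AT AN INERT GOOD PLACE» of file #34 `Theorems/K2LiuDoublingZetaGL1.lean` (LEAD F0P6-plan (g10) DEAL K2/STATUS
2026-09-04T02:36:29Z; REPORT-FIRST #34 v3, K2/K2Liu-p09/g3; DEPMAP v2.7 §13 `hInert` FEED TABLE row «(H)_v»).
-/
import Summits.HodgeConjecture.HodgeConjecture.Theorems.K2LiuDoublingZetaGL1Character      -- ★ O5 (p857472): `character_eq`, the split row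
import Summits.HodgeConjecture.HodgeConjecture.Theorems.K2LiuInertHeckeRecursion           -- ★ H3a (K2Liu-p01 g4): `natCard_residueField_eq_sq_inert`
import Literature.NumberTheory.Automorphic.SelfDualLatticeCountFrameTransportCM            -- ★ `valued_toPlace_uniformizer` (the `σ_w`-fixed uniformizer `ι_w(ϖ_v)`)
import Literature.NumberTheory.Automorphic.Liu2021.CheckOfChiLocal                         -- ★ `conjFiniteAdele_finiteAdeleSingle`, `localComponent_checkOfChi_apply`
import HarnessLib

/-!
# Crux `HLiu418`, Track B road `K2_Liu`, file #34 — organ O5-inert «`χ̌(ϖ_w) = 1` AND ★ #30s's HYPOTHESIS (H) AT AN INERT GOOD PLACE»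

Cell `hodgecm-mathlib`, crux item hLiu418 = `stmt-HodgeConjecture-24832`, route of record `HCCMUnconditional`; squad K2 ∕ K2Liu, prover K2Liu-p09 (g3).
THEOREMS ONLY (no `def`, no instance, no notation, no named-fact hypothesis, no `sorry`, default heartbeats); lane
`--supports stmt-HodgeConjecture-24832 --as helper` (count-neutral).

The inert twin of ★ O5 `K2LiuDoublingZetaGL1Character.splitPlace_H`.  At a place `v` of `L⁺` INERT and UNRAMIFIED in `L` (`w` the place above,
`c • w = w`), with `Ψ = λ̃⁻¹ λ̃ᶜ χ̌` (★ `character_eq`), `χ_D = λ̃⁻¹`, `Z := λ̃(ϖ_w)`, `θ := χ_D(ϖ_w) = Z⁻¹`, `q := q_v`, `N(w) = q²`: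
* §1 `valueAtUniformizer_checkOfChi_inert`: **`χ̌(ϖ_w) = 1`** when `χ̌` is unramified at `w` — read on the `σ_w`-FIXED, `L⁺`-rational uniformizer
  `ϖ = ι_w(ϖ_v)` (★ `valued_toPlace_uniformizer`; independence of the uniformizer ★ `localComponent_eq_valueAtUniformizer`): the norm-one idèle
  `single_w(ϖ) ∕ single_w(ϖ)ᶜ` is `1` because `(single_w ϖ)ᶜ = single_{c•w}(c ϖ) = single_w(ϖ)` (★ `conjFiniteAdele_finiteAdeleSingle`,
  ★ `galAdicCompletionMap_algebraMap`).  Hence `Ψ(ϖ_w) = Z⁻¹ · Z⁻¹ · 1 = θ²` (`λ̃ᶜ(ϖ_w) = λ̃(ϖ_{c•w}) = λ̃(ϖ_w)⁻¹`, ★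
  `valueAtUniformizer_toHeckeCharacter_complexConj_smul`).
* §2 `inertPlace_H`: ★ #28i's cleared identity (`K2LiuUnramifiedDoublingHeckeIdentityInert`, p857283) at `χ := χ_D` and at the θ-type eigenvalue of
  socket #24i `a₁(v) = q(Z + Z⁻¹) + q − 1` reads `c₀ · (1 − θ q(Z+Z⁻¹) q^{−(2s+2)} + θ² q^{−(4s+2)}) = (1 + θ q^{−(2s+1)})(1 − θ q^{−(2s+2)})`; since
  `θZ = 1` the bracket FACTORS as `(1 − q^{−(2s+1)})(1 − θ² q^{−(2s+1)}) = ∏_{w'∣v}(1 − N(w')^{−(s+½)})(1 − Ψ(ϖ_{w'}) N(w')^{−(s+½)})` (one place `w' = w`,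
  `N(w)^{−(s+½)} = q^{−(2s+1)}`), i.e. ★ #30s's (H) at `v` with `θ₁(v) := θ`, `θ₂(v) := −θ`:
  `c₀ · ∏ᶠ_{w'∣v}(…) = (1 − θ q_v^{−(2s+2)})(1 − (−θ) q_v^{−(2s+1)})`.

HONEST LABEL: HC_CM is proved only modulo the printed citations (2 remaining named inputs: hLiu418 = stmt-HodgeConjecture-24832,
h413 = stmt-HodgeConjecture-24833) until rung 0 closes; this file is bookkeeping toward socket s23 and closes no item.
References: [Liu2021] App. D §D.1 (l. 5224), proof of Lem. D.1 (inert places, l. 5226–5233); [GelbartRogawski1991] §3; [Li1992] §3 Thm. 3.1 (`b_2(s)`).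
-/

set_option autoImplicit false
set_option linter.dupNamespace false

noncomputable section

open NumberField IsDedekindDomain
open scoped NNReal Valued
open Literature.NumberTheory.Automorphic Literature.NumberTheory.Automorphic.IdeleClassGroup Literature.NumberTheory.Automorphic.UnitaryGroup
open Literature.NumberTheory.Automorphic.Liu2021 Literature.NumberTheory.Automorphic.Liu2021.Def411WeilCarriers
open Literature.NumberTheory.Automorphic.Liu2021.CheckOfChi
open Literature.NumberTheory.GaloisRepresentations
open Summit.HodgeConjecture.HodgeConjecture.Cruxes.HLiu418.K2LiuDoublingZetaGL1Character
open Summit.HodgeConjecture.HodgeConjecture.Cruxes.HLiu418.K2LiuInertHeckeRecursion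

namespace Summit.HodgeConjecture.HodgeConjecture.Cruxes.HLiu418.K2LiuDoublingZetaGL1CharacterInert

variable (L : Type) [Field L] [NumberField L] [IsCMField L]
  (lam : IdeleClassGroup L →ₜ* Circle) (χ : Chi (↥(maximalRealSubfield L)) L (IsCMField.complexConj L))

/-! ## §1 `χ̌(ϖ_w) = 1` at an inert unramified place -/

/-- **`χ̌(ϖ_w) = 1` AT AN INERT UNRAMIFIED PLACE** off the conductor of `χ̌`: for the `L⁺`-rational, `c_w`-fixed uniformizer `ϖ = ι_w(ϖ_v)` the
norm-one finite idèle `single_w(ϖ) ∕ single_w(ϖ)ᶜ` is trivial, and `χ̌(ϖ_w)` does not depend on the uniformizer.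
[cite: Liu2021, App. D §D.1 (l. 5224); Lemma D.1 (1) (l. 5229)] -/
theorem valueAtUniformizer_checkOfChi_inert {v : HeightOneSpectrum (𝓞 (↥(maximalRealSubfield L)))} (w : UnitaryGroup.PlacesOver L v)
    (hw : IsCMField.complexConj L • w.1 = w.1) (hv : Algebra.IsUnramifiedIn (𝓞 L) v.asIdeal)
    (hχ : (HeckeCharacter.checkOfChi (complexConj_mul_complexConj' L) χ).IsUnramifiedAt w.1) :
    (HeckeCharacter.checkOfChi (complexConj_mul_complexConj' L) χ).valueAtUniformizer w.1 = 1 := by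
  -- the `c_w`-fixed `L⁺`-rational uniformizer `ϖ = ι_w(ϖ_v) = (π : L_w)`, `π ∈ L⁺`
  obtain ⟨π, hπ⟩ : ∃ π : ↥(maximalRealSubfield L),
      (HeckeCharacter.uniformizer (↥(maximalRealSubfield L)) v : v.adicCompletion (↥(maximalRealSubfield L))) =
        (π : v.adicCompletion (↥(maximalRealSubfield L))) := ⟨_, rfl⟩
  have hϖv := valued_toPlace_uniformizer L v w hv
  have hϖ0 := toPlace_uniformizer_ne_zero L v w hv
  rw [hπ, toPlace_coe] at hϖv hϖ0
  set u : (w.1.adicCompletion L)ˣ := Units.mk0 _ hϖ0 with hudef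
  have huv : Valued.v (u : w.1.adicCompletion L) = WithZero.exp (-1 : ℤ) := by rw [hudef, Units.val_mk0]; exact hϖv
  rw [← HeckeCharacter.localComponent_eq_valueAtUniformizer hχ huv, localComponent_checkOfChi_apply]
  -- `(single_w ϖ)ᶜ = single_{c • w}(c ϖ) = single_w ϖ`
  have key : ∀ {w₁ w₂ : HeightOneSpectrum (𝓞 L)}, w₁ = w₂ → ∀ a : ↥(maximalRealSubfield L),
      finiteAdeleSingle w₁ ((algebraMap (↥(maximalRealSubfield L)) L a : L) : w₁.adicCompletion L) =
        finiteAdeleSingle w₂ ((algebraMap (↥(maximalRealSubfield L)) L a : L) : w₂.adicCompletion L) := by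
    rintro _ _ rfl a
    rfl
  have hU : Units.map (conjFiniteAdele (↥(maximalRealSubfield L)) L (IsCMField.complexConj L)).toMonoidHom (Units.map (finiteAdeleSingle w.1) u) =
      Units.map (finiteAdeleSingle w.1) u := by
    refine Units.ext ?_
    show conjFiniteAdele (↥(maximalRealSubfield L)) L (IsCMField.complexConj L)
        (finiteAdeleSingle w.1 ((algebraMap (↥(maximalRealSubfield L)) L π : L) : w.1.adicCompletion L)) =
      finiteAdeleSingle w.1 ((algebraMap (↥(maximalRealSubfield L)) L π : L) : w.1.adicCompletion L)
    rw [conjFiniteAdele_finiteAdeleSingle, galAdicCompletionMap_algebraMap]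
    exact key hw π
  have hone : finAdelicCheck (↥(maximalRealSubfield L)) L (IsCMField.complexConj L) (complexConj_mul_complexConj' L)
      (Units.map (finiteAdeleSingle w.1) u) = 1 := by
    apply Subtype.ext
    rw [coe_finAdelicCheck, hU, div_self']
    rfl
  rw [hone, map_one, Units.val_one]

/-- **`Ψ(ϖ_w) = λ̃(ϖ_w)⁻¹ · λ̃(ϖ_w)⁻¹` AT AN INERT UNRAMIFIED GOOD PLACE** (`λ̃` conjugate self-dual and unramified at `w`, `χ̌` unramified at `w`):
`Ψ = λ̃⁻¹ λ̃ᶜ χ̌`, `λ̃ᶜ(ϖ_w) = λ̃(ϖ_{c • w}) = λ̃(ϖ_w)⁻¹`, `χ̌(ϖ_w) = 1`. [cite: Liu2021, §4.1 (l. 1922); App. D Lem. D.1 (l. 5226–5233)] -/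
theorem valueAtUniformizer_character_inert (hlam : IsConjugateSymplectic L lam)
    {v : HeightOneSpectrum (𝓞 (↥(maximalRealSubfield L)))} (w : UnitaryGroup.PlacesOver L v)
    (hw : IsCMField.complexConj L • w.1 = w.1) (hv : Algebra.IsUnramifiedIn (𝓞 L) v.asIdeal)
    (hunr : (toHeckeCharacter L lam).IsUnramifiedAt w.1)
    (hχ : (HeckeCharacter.checkOfChi (complexConj_mul_complexConj' L) χ).IsUnramifiedAt w.1) :
    ((muAlg L lam)⁻¹ * (HeckeCharacter.galConj (IsCMField.complexConj L) (muAlg L lam) *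
        HeckeCharacter.checkOfChi (complexConj_mul_complexConj' L) χ)).valueAtUniformizer w.1 =
      ((toHeckeCharacter L lam).valueAtUniformizer w.1)⁻¹ * ((toHeckeCharacter L lam).valueAtUniformizer w.1)⁻¹ := by
  have hunr' : (toHeckeCharacter L lam).IsUnramifiedAt (IsCMField.complexConj L • w.1) := by rw [hw]; exact hunr
  rw [character_eq, HeckeCharacter.valueAtUniformizer_mul', HeckeCharacter.valueAtUniformizer_mul', HeckeCharacter.valueAtUniformizer_inv',
    HeckeCharacter.valueAtUniformizer_galConj_of_isUnramifiedAt (IsCMField.complexConj L) _ w.1 hunr',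
    valueAtUniformizer_toHeckeCharacter_complexConj_smul hlam.isConjugateSelfDual w.1 hunr',
    valueAtUniformizer_checkOfChi_inert L χ w hw hv hχ, mul_one]

/-! ## §2 ★ #30s's hypothesis (H) at an inert good place, from ★ #28i's cleared identity at #24i's eigenvalue -/

/-- complex powers of the residue cardinality at an inert place: `(q²)^{−(s+½)} = q^{−(2s+1)}`, `q · q^{−(2s+2)} = q^{−(2s+1)}`,
`q^{−(4s+2)} = (q^{−(2s+1)})²`. [folklore] -/
theorem sq_cpow_inert {q : ℕ} (hq : 0 < q) (s : ℂ) :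
    (((q ^ 2 : ℕ) : ℂ)) ^ (-(s + 1 / 2)) = (q : ℂ) ^ (-(2 * s + 1)) ∧
    (q : ℂ) * (q : ℂ) ^ (-(2 * s + 2)) = (q : ℂ) ^ (-(2 * s + 1)) ∧
    (q : ℂ) ^ (-(4 * s + 2)) = ((q : ℂ) ^ (-(2 * s + 1))) ^ 2 := by
  have hq0 : (q : ℂ) ≠ 0 := Nat.cast_ne_zero.2 hq.ne'
  refine ⟨?_, ?_, ?_⟩
  · rw [Nat.cast_pow, ← Complex.cpow_nat_mul' (x := (q : ℂ)) (n := 2) (by rw [Complex.natCast_arg, mul_zero]; exact neg_lt_zero.2 Real.pi_pos)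
      (by rw [Complex.natCast_arg, mul_zero]; exact Real.pi_pos.le)]
    congr 1; push_cast; ring
  · rw [show (q : ℂ) ^ (-(2 * s + 1)) = (q : ℂ) ^ ((1 : ℂ) + -(2 * s + 2)) by congr 1; ring, Complex.cpow_add _ _ hq0, Complex.cpow_one]
  · rw [← Complex.cpow_nat_mul]; congr 1; push_cast; ring

/-- **ORGAN O5-inert OF #34 — ★ #30s's (H) AT AN INERT GOOD PLACE.**  `v` inert and unramified in `L` (`w ∣ v`, `c • w = w`), `λ̃ = toHeckeCharacter L lam`
conjugate symplectic and unramified at `w`, `χ̌` unramified at `w`; `χ_D := toHeckeCharacter L lam⁻¹`, `θ := χ_D(ϖ_w)`, `Z := λ̃(ϖ_w)`, `q := q_v`.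
If `c₀` satisfies ★ #28i's cleared identity at `χ := χ_D` and at socket #24i's θ-type eigenvalue `a₁ := q(Z + Z⁻¹) + q − 1` (substituted verbatim), then
`c₀` satisfies ★ #30s's (H) at `v` with `ψ := Ψ`, `θ₁(v) := θ`, `θ₂(v) := −θ`:
`c₀ · ∏ᶠ_{w'∣v}(1 − N(w')^{−(s+½)})(1 − Ψ(ϖ_{w'}) N(w')^{−(s+½)}) = (1 − θ q^{−(2s+2)})(1 − (−θ) q^{−(2s+1)})`.
[cite: Liu2021, App. D proof of Lem. D.1 (inert places, l. 5226–5233)] [cite: GelbartRogawski1991, §3 pp. 455–459] [cite: Li1992, §3 Thm. 3.1] -/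
theorem inertPlace_H (hlam : IsConjugateSymplectic L lam)
    {v : HeightOneSpectrum (𝓞 (↥(maximalRealSubfield L)))} (w : UnitaryGroup.PlacesOver L v)
    (hw : IsCMField.complexConj L • w.1 = w.1) (hv : Algebra.IsUnramifiedIn (𝓞 L) v.asIdeal)
    (hunr : (toHeckeCharacter L lam).IsUnramifiedAt w.1)
    (hχ : (HeckeCharacter.checkOfChi (complexConj_mul_complexConj' L) χ).IsUnramifiedAt w.1)
    (s c₀ : ℂ)
    (hId : c₀ * (1 - (toHeckeCharacter L lam⁻¹).valueAtUniformizer w.1 *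
              ((v.residueCard : ℂ) *
                    ((toHeckeCharacter L lam).valueAtUniformizer w.1 + ((toHeckeCharacter L lam).valueAtUniformizer w.1)⁻¹) +
                  (v.residueCard : ℂ) - 1 - (v.residueCard : ℂ) + 1) * (v.residueCard : ℂ) ^ (-(2 * s + 2)) +
            (toHeckeCharacter L lam⁻¹).valueAtUniformizer w.1 ^ 2 * (v.residueCard : ℂ) ^ (-(4 * s + 2))) =
        (1 + (toHeckeCharacter L lam⁻¹).valueAtUniformizer w.1 * (v.residueCard : ℂ) ^ (-(2 * s + 1))) *
          (1 - (toHeckeCharacter L lam⁻¹).valueAtUniformizer w.1 * (v.residueCard : ℂ) ^ (-(2 * s + 2)))) :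
    c₀ * ∏ᶠ w' : UnitaryGroup.PlacesOver L v,
        ((1 - (w'.1.residueCard : ℂ) ^ (-(s + 1 / 2))) *
          (1 - ((muAlg L lam)⁻¹ * (HeckeCharacter.galConj (IsCMField.complexConj L) (muAlg L lam) *
              HeckeCharacter.checkOfChi (complexConj_mul_complexConj' L) χ)).valueAtUniformizer w'.1 * (w'.1.residueCard : ℂ) ^ (-(s + 1 / 2)))) =
      (1 - (toHeckeCharacter L lam⁻¹).valueAtUniformizer w.1 * (v.residueCard : ℂ) ^ (-(2 * s + 2))) *
        (1 - -(toHeckeCharacter L lam⁻¹).valueAtUniformizer w.1 * (v.residueCard : ℂ) ^ (-(2 * s + 1))) := by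
  classical
  set Ψ := (muAlg L lam)⁻¹ * (HeckeCharacter.galConj (IsCMField.complexConj L) (muAlg L lam) *
        HeckeCharacter.checkOfChi (complexConj_mul_complexConj' L) χ) with hΨdef
  set l : ℂ := (toHeckeCharacter L lam).valueAtUniformizer w.1 with hl
  set q : ℕ := v.residueCard with hqdef
  -- ### `c⁻¹ = c`, the fibre `{w' ∣ v} = {w}`, `N(w) = q²`
  have hcinv : (IsCMField.complexConj L)⁻¹ = IsCMField.complexConj L := inv_eq_of_mul_eq_one_right (complexConj_mul_complexConj' L)
  have hgal : UnitaryGroup.PlacesOver.galInv (IsCMField.complexConj L) w = w :=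
    Subtype.ext (by show (IsCMField.complexConj L)⁻¹ • w.1 = w.1; rw [hcinv, hw])
  have hfib : ∀ w' : UnitaryGroup.PlacesOver L v, w' = w := fun w' =>
    (UnitaryGroup.PlacesOver.eq_or_eq_galInv (IsCMField.complexConj L) (IsCMField.complexConj_ne_one L) w w').elim id fun h => h.trans hgal
  have hq1 : 1 < q := by
    rw [hqdef, HeightOneSpectrum.residueCard_eq_card_quotient]
    haveI : Finite (𝓞 (↥(maximalRealSubfield L)) ⧸ v.asIdeal) := Ideal.finiteQuotientOfFreeOfNeBot v.asIdeal v.ne_bot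
    haveI : v.asIdeal.IsPrime := v.isPrime
    haveI : IsDomain (𝓞 (↥(maximalRealSubfield L)) ⧸ v.asIdeal) := Ideal.Quotient.isDomain v.asIdeal
    exact Finite.one_lt_card
  have hqpos : 0 < q := by omega
  have hQ : w.1.residueCard = q ^ 2 := by
    have h1 : Nat.card 𝓀[w.1.adicCompletion L] = w.1.residueCard := by
      rw [HeightOneSpectrum.residueCard_eq_card_quotient]
      exact IsDedekindDomain.HeightOneSpectrum.natCard_residueField_adicCompletion L w.1
    rw [← h1, natCard_residueField_eq_sq_inert L v w hw hv]
  have hQc : (w.1.residueCard : ℂ) = (((q ^ 2 : ℕ) : ℂ)) := by rw [hQ]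
  obtain ⟨hXw, hqX, hX4⟩ := sq_cpow_inert hqpos s
  -- ### the local values
  have hl0 : l ≠ 0 := valueAtUniformizer_toHeckeCharacter_ne_zero lam w.1
  have hl : l⁻¹ * l = 1 := inv_mul_cancel₀ hl0
  have hχw : (toHeckeCharacter L lam⁻¹).valueAtUniformizer w.1 = l⁻¹ := by
    rw [toHeckeCharacter_inv, HeckeCharacter.valueAtUniformizer_inv']
  have hP : Ψ.valueAtUniformizer w.1 = l⁻¹ * l⁻¹ := valueAtUniformizer_character_inert L lam χ hlam w hw hv hunr hχ
  -- ### the algebra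
  rw [finprod_eq_single _ w (fun x hx => absurd (hfib x) hx), hQc, hXw, hP, hχw]
  rw [hχw, hX4] at hId
  linear_combination hId + (c₀ * (q : ℂ) ^ (-(2 * s + 1))) * hl + (c₀ * (l⁻¹ * l + l⁻¹ * l⁻¹)) * hqX

end Summit.HodgeConjecture.HodgeConjecture.Cruxes.HLiu418.K2LiuDoublingZetaGL1CharacterInert

end
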